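import Summits.MatrixMultiplication.MatrixMultiplication.Theses.SnSubsetDichotomy
import Summits.MatrixMultiplication.MatrixMultiplication.Theorems.SnSubsetDichotomyVershikKerovBound
import Summits.MatrixMultiplication.MatrixMultiplication.Theorems.SnSubsetDichotomyNoThresholdSubsetTripleStubTransfer
import Summits.MatrixMultiplication.MatrixMultiplication.Theorems.SnSubsetDichotomyDichotomyInduction

/-!
# `ThresholdSubsetTriples` (crux stmt-MatrixMultiplication-10882, route `SnSubsetDichotomy`) —
# negative-side support I: normal forms and load-bearing parts (refuter cdisprove seat; no refutation)

`X = ThresholdSubsetTriples`: `∀ c > 0, ∀ n₀, ∃ n ≥ n₀, ∃ S T U ⊆ S_n` with the TPP and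
`(n!)^{3/2}·e^{-c√n} < |S||T||U|` (written `Beats[c, n, S, T, U]`, a local notation).  Sorry-free content:

* §0 `¬X ↔ NoThresholdSubsetTriple` (crux 8302: a disproof of `X` IS a proof of that open crux);
  `X → MatrixMultiplication` (proved `closes` + `vershikKerovBound_proof`); `ThresholdAt c` is monotone in
  `c` (`thresholdAt_anti`) and the scales `1/(k+1)` suffice (`thresholdSubsetTriples_iff_nat`).
* §1 packing `|S||T||U| ≤ (n!)^{3/2}` for every TPP triple and every `n` (tree theorem
  `dichotomyInduction_card_le_rpow`), so the
  `c = 0` instance fails everywhere (`not_beats_zero`) and `0 < c` is load-bearing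
  (`thresholdSubsetTriples_false_without_pos`); cofinality and the TPP are what make `X` non-trivial
  (`thresholdSubsetTriplesWithoutCofinal_holds`: `n = 1`, `{1},{1},{1}`; `…WithoutTPP_holds`: `S_n`),
  so finite computation cannot refute `X` and any refutation is an `n → ∞` statement using the TPP.
-/

noncomputable section

set_option linter.dupNamespace false

open scoped BigOperators

namespace Summit.MatrixMultiplication.MatrixMultiplication.Theorems.ThresholdSubsetTriples.Negative

open Summit.MatrixMultiplication.MatrixMultiplication.Theses.SnSubsetDichotomy
open Summit.MatrixMultiplication.MatrixMultiplication.Theorems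
open Literature.Combinatorics.Additive
open Literature.Computability.AlgebraicComplexity
open Literature.Barriers.MatrixMultiplication

/-! ## §0 Normal forms and resistance -/

/-- `Beats[c, n, S, T, U]`: the volume condition of the crux at scale `c`,
`(n!)^{3/2}·e^{-c√n} < |S||T||U|` (local notation, no new definition). -/
local notation3 "Beats[" c ", " n ", " S ", " T ", " U "]" =>
  ((Nat.factorial n : ℕ) : ℝ) ^ ((3 : ℝ) / 2) * Real.exp (-(c * Real.sqrt ((n : ℕ) : ℝ))) <
    ((Finset.card S * Finset.card T * Finset.card U : ℕ) : ℝ)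

/-- `ThresholdAt[c]`: the crux at one fixed scale `c` (local notation). -/
local notation3 "ThresholdAt[" c "]" =>
  ∀ n₀ : ℕ, ∃ n ≥ n₀, ∃ S T U : Finset (Equiv.Perm (Fin n)),
    TripleProductProperty S T U ∧ Beats[c, n, S, T, U]

/-- `X` is literally `∀ c > 0, ThresholdAt c`. -/
theorem thresholdSubsetTriples_iff_forall_thresholdAt :
    ThresholdSubsetTriples ↔ ∀ c : ℝ, 0 < c → ThresholdAt[c] :=
  Iff.rfl

/-- The volume condition is monotone in the scale: a larger `c` is a weaker demand. -/
theorem beats_mono {c c' : ℝ} (hcc : c ≤ c') {n : ℕ} {S T U : Finset (Equiv.Perm (Fin n))}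
    (h : Beats[c, n, S, T, U]) : Beats[c', n, S, T, U] := by
  refine lt_of_le_of_lt ?_ h
  have hs : 0 ≤ Real.sqrt (n : ℝ) := Real.sqrt_nonneg _
  gcongr

/-- `ThresholdAt` is monotone in `c`; hence `¬X ↔ ∃ c > 0, ¬ThresholdAt c`, and refuting `X` means
refuting ONE positive scale (then all smaller ones fail too). -/
theorem thresholdAt_anti {c c' : ℝ} (hcc : c ≤ c') (h : ThresholdAt[c]) : ThresholdAt[c'] := by
  intro n₀
  obtain ⟨n, hn, S, T, U, hT, hB⟩ := h n₀
  exact ⟨n, hn, S, T, U, hT, beats_mono hcc hB⟩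

/-- `X → ¬ NoThresholdSubsetTriple`. -/
theorem not_noThreshold_of_threshold (h : ThresholdSubsetTriples) : ¬ NoThresholdSubsetTriple := by
  rintro ⟨c, hc, n₀, hN⟩
  obtain ⟨n, hn, S, T, U, hTPP, hlt⟩ := h c hc n₀
  exact absurd (hN n hn S T U hTPP) (not_le.2 hlt)

/-- `¬ NoThresholdSubsetTriple → X`. -/
theorem threshold_of_not_noThreshold (h : ¬ NoThresholdSubsetTriple) : ThresholdSubsetTriples := by
  intro c hc n₀
  by_contra hcon
  refine h ⟨c, hc, n₀, fun n hn S T U hTPP => ?_⟩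
  by_contra hle
  exact hcon ⟨n, hn, S, T, U, hTPP, not_le.1 hle⟩

/-- The target and the negative crux are each other's negation (support item
`NoThresholdIffNotThreshold`, here re-proved for self-containedness). -/
theorem thresholdSubsetTriples_iff_not_noThreshold :
    ThresholdSubsetTriples ↔ ¬ NoThresholdSubsetTriple :=
  ⟨not_noThreshold_of_threshold, threshold_of_not_noThreshold⟩

/-- **The disproof target.** `¬X` is EXACTLY crux `stmt-MatrixMultiplication-8302`. -/
theorem not_thresholdSubsetTriples_iff : ¬ ThresholdSubsetTriples ↔ NoThresholdSubsetTriple := by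
  rw [thresholdSubsetTriples_iff_not_noThreshold, not_not]

/-- **Resistance on the positive side.** `X` proves the summit `ω(ℂ) = 2` outright (the route's proved
deciding theorem `closes` and the proved Vershik–Kerov bound). -/
theorem matrixMultiplication_of_thresholdSubsetTriples (h : ThresholdSubsetTriples) :
    _root_.MatrixMultiplication :=
  closes h vershikKerovBound_proof

/-! ## §1 Load-bearing parts of the statement -/

/-- The `c = 0` instance of the volume condition fails for EVERY TPP triple at EVERY `n`
(it asks to beat the packing bound). -/
theorem not_beats_zero {n : ℕ} {S T U : Finset (Equiv.Perm (Fin n))}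
    (h : TripleProductProperty S T U) : ¬ Beats[0, n, S, T, U] := by
  rw [zero_mul, neg_zero, Real.exp_zero, mul_one, not_lt]
  exact dichotomyInduction_card_le_rpow h

/-- **`0 < c` is load-bearing**: `X` with the positivity hypothesis dropped is FALSE (witness `c = 0`,
packing). -/
theorem thresholdSubsetTriples_false_without_pos :
    ¬ (∀ c : ℝ, ∀ n₀ : ℕ, ∃ n ≥ n₀, ∃ S T U : Finset (Equiv.Perm (Fin n)),
      TripleProductProperty S T U ∧ Beats[c, n, S, T, U]) := by
  intro h
  obtain ⟨n, -, S, T, U, hTPP, hlt⟩ := h 0 0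
  exact not_beats_zero hTPP hlt

/-- The one-element triple `{1}, {1}, {1}` has the TPP in every group. -/
theorem tpp_singleton_one {G : Type*} [Group G] [DecidableEq G] :
    TripleProductProperty ({1} : Finset G) {1} {1} := by
  intro s hs s' hs' t ht t' ht' u hu u' hu' _
  simp only [Finset.mem_singleton] at hs hs' ht ht' hu hu'
  exact ⟨hs.trans hs'.symm, ht.trans ht'.symm, hu.trans hu'.symm⟩

/-- At `n = 1` the trivial triple beats every positive scale: `1 > 1^{3/2}·e^{-c}`. -/
theorem beats_one_singleton {c : ℝ} (hc : 0 < c) :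
    Beats[c, 1, ({1} : Finset (Equiv.Perm (Fin 1))), ({1} : Finset (Equiv.Perm (Fin 1))),
      ({1} : Finset (Equiv.Perm (Fin 1)))] := by
  have h : Real.exp (-c) < 1 := Real.exp_lt_one_iff.2 (neg_lt_zero.2 hc)
  simpa using h

/-- **Cofinality is what makes `X` non-trivial**: without `∀ n₀` it holds at `n = 1` for every `c > 0`
(so no bounded search in small `S_n` bears on `X`; at `n = 0` the bound is `1 < 1`, false). -/
theorem thresholdSubsetTriplesWithoutCofinal_holds :
    ∀ c : ℝ, 0 < c → ∃ n : ℕ, ∃ S T U : Finset (Equiv.Perm (Fin n)),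
      TripleProductProperty S T U ∧ Beats[c, n, S, T, U] :=
  fun _ hc => ⟨1, {1}, {1}, {1}, tpp_singleton_one, beats_one_singleton hc⟩

/-- `S_n, S_n, S_n` beats every positive scale as soon as `n ≥ 1` (volume `(n!)³`). -/
theorem beats_univ {c : ℝ} (hc : 0 < c) {n : ℕ} (hn : 1 ≤ n) :
    Beats[c, n, (Finset.univ : Finset (Equiv.Perm (Fin n))), (Finset.univ : Finset (Equiv.Perm (Fin n))),
      (Finset.univ : Finset (Equiv.Perm (Fin n)))] := by
  have hF1 : (1 : ℝ) ≤ (n.factorial : ℝ) := by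
    exact_mod_cast Nat.succ_le_of_lt (Nat.factorial_pos n)
  have hcard : (Finset.univ : Finset (Equiv.Perm (Fin n))).card = n.factorial := by
    rw [Finset.card_univ, Fintype.card_perm, Fintype.card_fin]
  rw [hcard]
  have hexp : Real.exp (-(c * Real.sqrt (n : ℝ))) < 1 := by
    rw [Real.exp_lt_one_iff, neg_lt_zero]
    exact mul_pos hc (Real.sqrt_pos.2 (by exact_mod_cast hn))
  have hpow : (n.factorial : ℝ) ^ ((3 : ℝ) / 2) ≤ (n.factorial : ℝ) ^ ((3 : ℝ)) :=
    Real.rpow_le_rpow_of_exponent_le hF1 (by norm_num)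
  calc (n.factorial : ℝ) ^ ((3 : ℝ) / 2) * Real.exp (-(c * Real.sqrt (n : ℝ)))
      < (n.factorial : ℝ) ^ ((3 : ℝ) / 2) * 1 := mul_lt_mul_of_pos_left hexp (by positivity)
    _ ≤ (n.factorial : ℝ) ^ ((3 : ℝ)) := by rw [mul_one]; exact hpow
    _ = ((n.factorial * n.factorial * n.factorial : ℕ) : ℝ) := by
        rw [show (3 : ℝ) = ((3 : ℕ) : ℝ) by norm_num, Real.rpow_natCast]
        push_cast
        ring

/-- **The TPP is load-bearing** (trivially): without it the volume condition is met by `S_n` itself. -/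
theorem thresholdSubsetTriplesWithoutTPP_holds :
    ∀ c : ℝ, 0 < c → ∀ n₀ : ℕ, ∃ n ≥ n₀, ∃ S T U : Finset (Equiv.Perm (Fin n)), Beats[c, n, S, T, U] :=
  fun _ hc n₀ => ⟨max n₀ 1, le_max_left _ _, Finset.univ, Finset.univ, Finset.univ,
    beats_univ hc (le_max_right _ _)⟩


end Summit.MatrixMultiplication.MatrixMultiplication.Theorems.ThresholdSubsetTriples.Negative

end
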